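import Mathlib
import HarnessLib
import Summits.CriticalPhenomena.CardyFormulaZ2.Theses.CardyGluingRDE

/-!
# `ContractionGivesMerging` (route CardyGluingRDE, item stmt-CriticalPhenomena-8583)

The support item `GluingContraction → BoxMerging` of route CardyGluingRDE is pure real analysis:
writing `TV_j(u,u')` for the total-variation distance between the bond-`ℤ²` (mesh `u`) and
site-`𝕋` (mesh `u'`) laws of the resolution-`j` segment-connectivity matrix of the square, and
`Dw_K = Σ_{j ≤ K} 2^{-σ j} TV_j`, the hypothesis gives (A) a local contraction
`Dw_K(u/2^m, u'/2^m) ≤ θ Dw_K(u,u') + C 2^{-κ K}` inside the `ρ`-ball and (B) an entry window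
`[u_Z/2^m, u_Z] × (0, δT]` on which `Dw_K ≤ ρ/2`.  Iterating (A) from (B) (geometric series) gives
`Dw_K(u/q^n, u'/q^n) ≤ θ^n ρ/2 + C 2^{-κK}/(1-θ)` (`q = 2^m`), hence `TV_j ≤ 2^{σ j} Dw_K` is small
on the coupled windows `a ∈ [u_Z/q^{n+1}, u_Z/q^n]`, `b ≤ δT/q^n`; the two meshes are decoupled by
the four-point triangle inequality `TV_j(a,b) ≤ TV_j(a,b') + TV_j(a',b') + TV_j(a',b)` with
`a' = u_Z/q^{n₀}` and `b' = δT/q^{n(a)}`.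

Design: the analysis is proved ONCE for an abstract nonnegative kernel `TV : ℝ → ℕ → ℝ → ℝ → ℝ`
satisfying the four-point inequality (`merging_of_contraction`, hypothesis shaped literally like
the body of `GluingContraction`, conclusion shaped literally like the body of `BoxMerging`); the
route statement then follows by unification (the two route definitions share their `let`-prefix,
so the same kernel appears on both sides).  No percolation input is used.

References: the route card (Langlands' finite models, arXiv:math/9401222 §2; Schramm–Smirnov 2011,
Question 2); the real-analysis step is folklore.
-/

namespace Summit.CriticalPhenomena.CardyFormulaZ2.Theorems

namespace ContractionGivesMerging

open Filter Topology

/-- The total-variation functional `(1/2) Σ_i |x_i - y_i|` is nonnegative. [folklore] -/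
theorem half_sum_abs_sub_nonneg {ι : Type*} (s : Finset ι) (x y : ι → ℝ) :
    0 ≤ (1 / 2 : ℝ) * ∑ i ∈ s, |x i - y i| := by
  positivity

/-- Four-point triangle inequality for the total-variation functional between two families:
`TV(x,y) ≤ TV(x,y') + TV(x',y') + TV(x',y)`. [folklore] -/
theorem half_sum_abs_sub_le {ι : Type*} (s : Finset ι) (x x' y y' : ι → ℝ) :
    (1 / 2 : ℝ) * ∑ i ∈ s, |x i - y i| ≤
      (1 / 2 : ℝ) * ∑ i ∈ s, |x i - y' i| + (1 / 2 : ℝ) * ∑ i ∈ s, |x' i - y' i| +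
        (1 / 2 : ℝ) * ∑ i ∈ s, |x' i - y i| := by
  rw [← mul_add, ← mul_add, ← Finset.sum_add_distrib, ← Finset.sum_add_distrib]
  gcongr with i
  calc |x i - y i| = |(x i - y' i) + (y' i - x' i) + (x' i - y i)| := by congr 1; ring
    _ ≤ |(x i - y' i) + (y' i - x' i)| + |x' i - y i| := abs_add_le _ _
    _ ≤ |x i - y' i| + |y' i - x' i| + |x' i - y i| := by gcongr; exact abs_add_le _ _
    _ = |x i - y' i| + |x' i - y' i| + |x' i - y i| := by rw [abs_sub_comm (y' i) (x' i)]

/-- ABSTRACT MERGING LEMMA (the real analysis of `ContractionGivesMerging`).  For a nonnegative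
kernel `TV δ₀ j u u'` satisfying the four-point triangle inequality in `(u, u')` and the
multiresolution sums `Dw σ δ₀ K u u' = Σ_{j ≤ K} 2^{-σ j} TV δ₀ j u u'`: local contraction of
`Dw` under `(u,u') ↦ (u/2^m, u'/2^m)` up to a slack `C 2^{-κ K}`, together with an entry window,
forces `TV δ₀ j u u' → 0` as `u, u' → 0` independently.  The hypothesis is, up to unfolding, the
body of `GluingContraction`, the conclusion the body of `BoxMerging`. [folklore] -/
theorem merging_of_contraction {TV : ℝ → ℕ → ℝ → ℝ → ℝ} {Dw : ℝ → ℝ → ℕ → ℝ → ℝ → ℝ}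
    (hTV0 : ∀ δ₀ j u u', 0 ≤ TV δ₀ j u u')
    (hTVtri : ∀ δ₀ j a b a' b', TV δ₀ j a b ≤ TV δ₀ j a b' + TV δ₀ j a' b' + TV δ₀ j a' b)
    (hDw : ∀ σ δ₀ K u u', Dw σ δ₀ K u u' =
      ∑ j ∈ Finset.range (K + 1), (2 : ℝ) ^ (-(σ * (j : ℝ))) * TV δ₀ j u u')
    (h : ∃ σ θ C κ ρ : ℝ, ∃ m : ℕ, 0 < σ ∧ 0 ≤ θ ∧ θ < 1 ∧ 0 < C ∧ 0 < κ ∧ 0 < ρ ∧ 1 ≤ m ∧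
      ∀ δ₀ : ℝ, 0 < δ₀ → ∀ K : ℕ, ∃ δT : ℝ, 0 < δT ∧
        (∀ u u' : ℝ, 0 < u → u ≤ δ₀ / (C * 2 ^ K) → 0 < u' → u' ≤ δT →
          Dw σ δ₀ K u u' ≤ ρ →
            Dw σ δ₀ K (u / 2 ^ m) (u' / 2 ^ m) ≤
              θ * Dw σ δ₀ K u u' + C * (2 : ℝ) ^ (-(κ * (K : ℝ)))) ∧
        (∃ uZ : ℝ, 0 < uZ ∧ uZ ≤ δ₀ / (C * 2 ^ K) ∧ ∀ u u' : ℝ, uZ / 2 ^ m ≤ u → u ≤ uZ →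
          0 < u' → u' ≤ δT → Dw σ δ₀ K u u' ≤ ρ / 2)) :
    ∀ δ₀ : ℝ, 0 < δ₀ → ∀ (j : ℕ) (ε : ℝ), 0 < ε → ∃ η : ℝ, 0 < η ∧
      ∀ u u' : ℝ, 0 < u → u < η → 0 < u' → u' < η → TV δ₀ j u u' ≤ ε := by
  obtain ⟨σ, θ, C, κ, ρ, m, _hσ, hθ0, hθ1, hC, hκ, hρ, hm, hmain⟩ := h
  intro δ₀ hδ₀ j ε hε
  have h1θ : 0 < 1 - θ := sub_pos.mpr hθ1
  -- the slack `C 2^{-κK}` is `C r^K` with `r = 2^{-κ} < 1`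
  obtain ⟨r, hr⟩ : ∃ r : ℝ, r = (2 : ℝ) ^ (-κ) := ⟨_, rfl⟩
  have hr0 : 0 ≤ r := by rw [hr]; exact Real.rpow_nonneg (by norm_num) _
  have hr1 : r < 1 := by
    rw [hr]; exact Real.rpow_lt_one_of_one_lt_of_neg (by norm_num) (by linarith)
  have hsK : ∀ K : ℕ, (2 : ℝ) ^ (-(κ * (K : ℝ))) = r ^ K := by
    intro K
    rw [hr, ← Real.rpow_natCast, ← Real.rpow_mul (by norm_num : (0 : ℝ) ≤ 2)]
    congr 1
    ring
  -- the resolution weight `A = 2^{σ j}`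
  obtain ⟨A, hA⟩ : ∃ A : ℝ, A = (2 : ℝ) ^ (σ * (j : ℝ)) := ⟨_, rfl⟩
  have hA0 : 0 < A := by rw [hA]; exact Real.rpow_pos_of_pos (by norm_num) _
  have hAA : A * (2 : ℝ) ^ (-(σ * (j : ℝ))) = 1 := by
    rw [hA, ← Real.rpow_add (by norm_num : (0 : ℝ) < 2), add_neg_cancel, Real.rpow_zero]
  -- choose `K ≥ j` with slack `s = C 2^{-κK}` below both thresholds
  obtain ⟨t, ht⟩ : ∃ t : ℝ, t = min (ρ * (1 - θ) / 2) (ε * (1 - θ) / (6 * A)) := ⟨_, rfl⟩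
  have ht0 : 0 < t := by rw [ht]; exact lt_min (by positivity) (by positivity)
  have htC : 0 < t / C := div_pos ht0 hC
  obtain ⟨K, hKj, hK⟩ : ∃ K : ℕ, j ≤ K ∧ r ^ K < t / C :=
    ((eventually_ge_atTop j).and
      ((tendsto_pow_atTop_nhds_zero_of_lt_one hr0 hr1).eventually (gt_mem_nhds htC))).exists
  obtain ⟨s, hs⟩ : ∃ s : ℝ, s = C * (2 : ℝ) ^ (-(κ * (K : ℝ))) := ⟨_, rfl⟩
  have hs0 : 0 ≤ s := by rw [hs]; positivity
  have hst : s ≤ t := by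
    rw [hs, hsK, mul_comm]
    exact ((lt_div_iff₀ hC).mp hK).le
  have hs1 : s / (1 - θ) ≤ ρ / 2 := by
    rw [div_le_iff₀ h1θ]
    have h1 : t ≤ ρ * (1 - θ) / 2 := by rw [ht]; exact min_le_left _ _
    linarith [hst.trans h1]
  have hs2 : A * (s / (1 - θ)) ≤ ε / 6 := by
    have h0 : t ≤ ε * (1 - θ) / (6 * A) := by rw [ht]; exact min_le_right _ _
    have h1 : s ≤ ε * (1 - θ) / (6 * A) := hst.trans h0
    have hA0' : A ≠ 0 := hA0.ne'
    have h1θ' : (1 : ℝ) - θ ≠ 0 := h1θ.ne'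
    calc A * (s / (1 - θ)) ≤ A * (ε * (1 - θ) / (6 * A) / (1 - θ)) := by gcongr
      _ = ε / 6 := by field_simp
  -- contraction data at this `K`
  obtain ⟨δT, hδT, hA', uZ, huZ0, huZb, hB⟩ := hmain δ₀ hδ₀ K
  -- `q = 2^m > 1`
  obtain ⟨q, hq⟩ : ∃ q : ℝ, q = 2 ^ m := ⟨_, rfl⟩
  have hq1 : (1 : ℝ) < q := by rw [hq]; exact one_lt_pow₀ (by norm_num) (by omega)
  have hq0 : 0 < q := by positivity
  have hq1' : (1 : ℝ) ≤ q := hq1.le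
  -- iteration of (A) from (B): geometric series
  have iter : ∀ n : ℕ, ∀ u u' : ℝ, uZ / q ≤ u → u ≤ uZ → 0 < u' → u' ≤ δT →
      Dw σ δ₀ K (u / q ^ n) (u' / q ^ n) ≤ θ ^ n * (ρ / 2) + s / (1 - θ) := by
    intro n
    induction n with
    | zero =>
      intro u u' hu1 hu2 hu'1 hu'2
      have hb := hB u u' (by rw [← hq]; exact hu1) hu2 hu'1 hu'2
      have : 0 ≤ s / (1 - θ) := div_nonneg hs0 h1θ.le
      simp only [pow_zero, div_one, one_mul]
      linarith
    | succ n ih =>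
      intro u u' hu1 hu2 hu'1 hu'2
      have hu0 : 0 < u := lt_of_lt_of_le (div_pos huZ0 hq0) hu1
      have hqn : (1 : ℝ) ≤ q ^ n := one_le_pow₀ hq1'
      have hqn0 : (0 : ℝ) < q ^ n := by positivity
      have ih' := ih u u' hu1 hu2 hu'1 hu'2
      have h1 : 0 < u / q ^ n := div_pos hu0 hqn0
      have h2 : u / q ^ n ≤ δ₀ / (C * 2 ^ K) :=
        (div_le_self hu0.le hqn).trans (hu2.trans huZb)
      have h3 : 0 < u' / q ^ n := div_pos hu'1 hqn0
      have h4 : u' / q ^ n ≤ δT := (div_le_self hu'1.le hqn).trans hu'2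
      have hθn : θ ^ n ≤ 1 := pow_le_one₀ hθ0 hθ1.le
      have h5 : Dw σ δ₀ K (u / q ^ n) (u' / q ^ n) ≤ ρ := by
        have : θ ^ n * (ρ / 2) ≤ 1 * (ρ / 2) := by gcongr
        linarith
      have step := hA' (u / q ^ n) (u' / q ^ n) h1 h2 h3 h4 h5
      have e1 : u / q ^ n / 2 ^ m = u / q ^ (n + 1) := by rw [pow_succ, ← hq, div_div]
      have e2 : u' / q ^ n / 2 ^ m = u' / q ^ (n + 1) := by rw [pow_succ, ← hq, div_div]
      rw [e1, e2, ← hs] at step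
      have hmono : θ * Dw σ δ₀ K (u / q ^ n) (u' / q ^ n) ≤
          θ * (θ ^ n * (ρ / 2) + s / (1 - θ)) := mul_le_mul_of_nonneg_left ih' hθ0
      have h1θ' : (1 : ℝ) - θ ≠ 0 := h1θ.ne'
      calc Dw σ δ₀ K (u / q ^ (n + 1)) (u' / q ^ (n + 1))
          ≤ θ * (θ ^ n * (ρ / 2) + s / (1 - θ)) + s := step.trans (by linarith)
        _ = θ ^ (n + 1) * (ρ / 2) + s / (1 - θ) := by
          field_simp
          ring
  -- the coupled windows
  have win : ∀ n : ℕ, ∀ a b : ℝ, uZ / q ^ (n + 1) ≤ a → a ≤ uZ / q ^ n → 0 < b →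
      b ≤ δT / q ^ n → Dw σ δ₀ K a b ≤ θ ^ n * (ρ / 2) + s / (1 - θ) := by
    intro n a b ha1 ha2 hb1 hb2
    have hqn0 : (0 : ℝ) < q ^ n := by positivity
    have g1 : uZ / q ≤ a * q ^ n := by
      rw [div_le_iff₀ hq0]
      have := (div_le_iff₀ (by positivity : (0 : ℝ) < q ^ (n + 1))).mp ha1
      simpa [pow_succ, mul_assoc] using this
    have g2 : a * q ^ n ≤ uZ := (le_div_iff₀ hqn0).mp ha2
    have g3 : b * q ^ n ≤ δT := (le_div_iff₀ hqn0).mp hb2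
    have key := iter n (a * q ^ n) (b * q ^ n) g1 g2 (by positivity) g3
    rwa [mul_div_cancel_right₀ _ hqn0.ne', mul_div_cancel_right₀ _ hqn0.ne'] at key
  -- `TV_j ≤ 2^{σ j} Dw_K` for `j ≤ K`
  have tv_le : ∀ a b : ℝ, TV δ₀ j a b ≤ A * Dw σ δ₀ K a b := by
    intro a b
    rw [hDw]
    have hmem : j ∈ Finset.range (K + 1) := Finset.mem_range.mpr (Nat.lt_succ_of_le hKj)
    have hle : (2 : ℝ) ^ (-(σ * (j : ℝ))) * TV δ₀ j a b ≤
        ∑ i ∈ Finset.range (K + 1), (2 : ℝ) ^ (-(σ * (i : ℝ))) * TV δ₀ i a b :=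
      Finset.single_le_sum (f := fun i : ℕ => (2 : ℝ) ^ (-(σ * (i : ℝ))) * TV δ₀ i a b)
        (fun i _ => mul_nonneg (Real.rpow_nonneg (by norm_num) _) (hTV0 _ _ _ _)) hmem
    calc TV δ₀ j a b = A * ((2 : ℝ) ^ (-(σ * (j : ℝ))) * TV δ₀ j a b) := by
          rw [← mul_assoc, hAA, one_mul]
      _ ≤ A * ∑ i ∈ Finset.range (K + 1), (2 : ℝ) ^ (-(σ * (i : ℝ))) * TV δ₀ i a b :=
          mul_le_mul_of_nonneg_left hle hA0.le
  -- depth `n₀` beyond which the geometric term is below `ε/6`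
  have hpos : 0 < ε / (3 * A * ρ) := by positivity
  obtain ⟨n₀, hn₀⟩ : ∃ n₀ : ℕ, θ ^ n₀ < ε / (3 * A * ρ) :=
    ((tendsto_pow_atTop_nhds_zero_of_lt_one hθ0 hθ1).eventually (gt_mem_nhds hpos)).exists
  have small : ∀ n, n₀ ≤ n → A * (θ ^ n * (ρ / 2) + s / (1 - θ)) ≤ ε / 3 := by
    intro n hn
    have hθn : θ ^ n ≤ θ ^ n₀ := pow_le_pow_of_le_one hθ0 hθ1.le hn
    have hθn' : θ ^ n ≤ ε / (3 * A * ρ) := hθn.trans hn₀.le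
    have hA0' : A ≠ 0 := hA0.ne'
    have hρ' : ρ ≠ 0 := hρ.ne'
    have h1 : A * (θ ^ n * (ρ / 2)) ≤ ε / 6 :=
      calc A * (θ ^ n * (ρ / 2)) ≤ A * (ε / (3 * A * ρ) * (ρ / 2)) := by gcongr
        _ = ε / 6 := by field_simp; ring
    calc A * (θ ^ n * (ρ / 2) + s / (1 - θ))
        = A * (θ ^ n * (ρ / 2)) + A * (s / (1 - θ)) := by ring
      _ ≤ ε / 6 + ε / 6 := add_le_add h1 hs2
      _ = ε / 3 := by ring
  -- the common smallness threshold
  have hqn₀0 : (0 : ℝ) < q ^ n₀ := by positivity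
  refine ⟨min (uZ / q ^ n₀) (δT / q ^ n₀), lt_min (by positivity) (by positivity), ?_⟩
  intro a b ha0 haη hb0 hbη
  have ha1 : a < uZ / q ^ n₀ := lt_of_lt_of_le haη (min_le_left _ _)
  have hb1 : b < δT / q ^ n₀ := lt_of_lt_of_le hbη (min_le_right _ _)
  -- locate the window `[uZ/q^(n+1), uZ/q^n]` containing `a`
  have hex : ∃ n : ℕ, uZ / q ^ (n + 1) ≤ a := by
    obtain ⟨n, hn⟩ := pow_unbounded_of_one_lt (uZ / a) hq1
    refine ⟨n, ?_⟩
    have hqn0 : (0 : ℝ) < q ^ n := by positivity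
    have g1 : uZ / q ^ n < a := by
      rw [div_lt_iff₀ hqn0]
      have := (div_lt_iff₀ ha0).mp hn
      linarith [mul_comm a (q ^ n)]
    have g2 : uZ / q ^ (n + 1) ≤ uZ / q ^ n := by
      apply div_le_div_of_nonneg_left huZ0.le hqn0
      rw [pow_succ]
      exact le_mul_of_one_le_right hqn0.le hq1'
    linarith
  classical
  obtain ⟨n, hn1, hnmin⟩ : ∃ n : ℕ, uZ / q ^ (n + 1) ≤ a ∧ ∀ k, k < n → ¬ uZ / q ^ (k + 1) ≤ a :=
    ⟨Nat.find hex, Nat.find_spec hex, fun k hk => Nat.find_min hex hk⟩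
  have hn2 : a ≤ uZ / q ^ n := by
    rcases Nat.eq_zero_or_pos n with h0 | hpos'
    · rw [h0, pow_zero, div_one]
      have : uZ / q ^ n₀ ≤ uZ := div_le_self huZ0.le (one_le_pow₀ hq1')
      linarith
    · have hk := hnmin (n - 1) (by omega)
      have e : n - 1 + 1 = n := by omega
      rw [not_le, e] at hk
      exact hk.le
  have hn3 : n₀ ≤ n := by
    by_contra hlt
    push Not at hlt
    have : uZ / q ^ n₀ ≤ uZ / q ^ (n + 1) := by
      apply div_le_div_of_nonneg_left huZ0.le (by positivity)
      exact pow_le_pow_right₀ hq1' (by omega)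
    linarith
  -- the three small TV's and the four-point inequality
  have hqn0 : (0 : ℝ) < q ^ n := by positivity
  have hb'0 : 0 < δT / q ^ n := by positivity
  have hb'1 : δT / q ^ n ≤ δT / q ^ n₀ := by
    apply div_le_div_of_nonneg_left hδT.le hqn₀0
    exact pow_le_pow_right₀ hq1' hn3
  have ha'1 : uZ / q ^ (n₀ + 1) ≤ uZ / q ^ n₀ := by
    apply div_le_div_of_nonneg_left huZ0.le hqn₀0
    rw [pow_succ]
    exact le_mul_of_one_le_right hqn₀0.le hq1'
  have T1 : TV δ₀ j a (δT / q ^ n) ≤ ε / 3 :=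
    (tv_le _ _).trans ((mul_le_mul_of_nonneg_left (win n a _ hn1 hn2 hb'0 le_rfl) hA0.le).trans
      (small n hn3))
  have T2 : TV δ₀ j (uZ / q ^ n₀) (δT / q ^ n) ≤ ε / 3 :=
    (tv_le _ _).trans ((mul_le_mul_of_nonneg_left (win n₀ _ _ ha'1 le_rfl hb'0 hb'1) hA0.le).trans
      (small n₀ le_rfl))
  have T3 : TV δ₀ j (uZ / q ^ n₀) b ≤ ε / 3 :=
    (tv_le _ _).trans ((mul_le_mul_of_nonneg_left (win n₀ _ _ ha'1 le_rfl hb0 hb1.le) hA0.le).trans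
      (small n₀ le_rfl))
  calc TV δ₀ j a b ≤ TV δ₀ j a (δT / q ^ n) + TV δ₀ j (uZ / q ^ n₀) (δT / q ^ n) +
        TV δ₀ j (uZ / q ^ n₀) b := hTVtri δ₀ j a b _ _
    _ ≤ ε / 3 + ε / 3 + ε / 3 := by gcongr
    _ = ε := by ring

end ContractionGivesMerging

/-- **`ContractionGivesMerging`** (support item stmt-CriticalPhenomena-8583 of route
CardyGluingRDE): `GluingContraction → BoxMerging` — local contraction of the multiresolution
total-variation discrepancy between the bond-`ℤ²` and site-`𝕋` square-boundary laws under
mesh-halving, from the lattice-resolution onset and with an entry window, forces the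
resolution-`j` laws to merge as both meshes tend to `0`.  Pure real analysis
(`ContractionGivesMerging.merging_of_contraction`); the route definitions are consumed by
unification. [folklore] -/
theorem ContractionGivesMerging_proof :
    Summit.CriticalPhenomena.CardyFormulaZ2.Theses.CardyGluingRDE.ContractionGivesMerging := by
  intro hX
  refine ContractionGivesMerging.merging_of_contraction ?_ ?_ ?_ hX
  · intro δ₀ j u u'
    exact ContractionGivesMerging.half_sum_abs_sub_nonneg _ _ _
  · intro δ₀ j a b a' b'
    exact ContractionGivesMerging.half_sum_abs_sub_le _ _ _ _ _
  · intro σ δ₀ K u u'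
    rfl

end Summit.CriticalPhenomena.CardyFormulaZ2.Theorems
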